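import Summits.ResolutionOfSingularities.ResolutionOfSingularities.Theorems.PAlterationPialtSqueeze
import Summits.ResolutionOfSingularities.ResolutionOfSingularities.Theorems.PAlterationPalterationThesisIffSummit
import Literature.AlgebraicGeometry.Resolution.ProperModelsPatchingOfResolution
import HarnessLib

/-!
# `Pialt` (crux stmt-ResolutionOfSingularities-0555), line `SketchIdeator2` / Card A: the sharp form of
# the squeeze — local uniformization in characteristic `p` IS local uniformization of normal
# radicially regular affine varieties (modulo `Temkin2013`), over EVERY field

Helper file of the line lead (c1), companion of `Theorems/PAlterationPialtSqueeze.lean`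
(`--supports stmt-ResolutionOfSingularities-0555`; it does not close any item).

`PAlterationPialtSqueeze.lean` feeds the crux `Picover` (RESOLUTION of finite radicial covers of
regular varieties) into Zariski's programme through Frobenius domination, which needs a perfect
(or F-finite) ground field. Zariski's programme only consumes LOCAL UNIFORMIZATION, and the
Frobenius sandwich `T = B ∩ K` of `exists_normal_rrModel_le_of_temkin2013` needs no hypothesis
on the ground field. Hence the sharp statements of this file, over every field of
characteristic `p`, with the hypothesis "RRLU at `p`" INLINED (no new definition):

> RRLU_p: for every field `k` of characteristic `p`, every field `K ⊇ k`, every finitely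
> generated, integrally closed `k`-subalgebra `T ⊆ K` with `Frac T = K` such that an integral
> REGULAR scheme maps onto `Spec T` finitely, universally injectively and surjectively, and every
> valuation ring `O ⊇ T` of `K`: `O` is locally uniformizable over `k`
> (local uniformization of valuations centred on normal radicially regular affine varieties —
> Temkin's "inseparable case", Temkin 2013 Rem. 1.3.5 (iii); `Spec T → Spec B` is a finite
> radicial SANDWICH `B^q ⊆ T ⊆ B` of the regular `B`).

* `localUniformizationInChar_of_temkin2013_of_rrLU`, `rrLU_of_localUniformizationInChar`,
  `localUniformizationInChar_iff_rrLU` — **modulo `Temkin2013`, `LocalUniformizationInChar p ↔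
  RRLU_p`**: Zariski local uniformization in characteristic `p` is EXACTLY local uniformization
  in the inseparable case.
* `resolutionInChar_of_temkin2013_rrLU_twoModelPatching`,
  `resolutionInChar_iff_rrLU_and_twoModelPatching` — with the tree's
  `resolutionInChar_iff_twoModelPatching_and_lu` (Zariski–Piltant with proper models):
  **modulo `Temkin2013`, `ResolutionInChar p ↔ RRLU_p ∧ ProperModel.TwoModelPatching p`** over
  ALL fields of characteristic `p` — sharper than `resolutionOfSingularities_iff_picover_and_twoModelPatching`
  (`PAlterationPialtSqueezeSummit.lean`): local uniformization instead of resolution of the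
  radicial covers, and no route assembly.
* `resolutionOfSingularities_of_temkin2013_rrLU_twoModelPatching`,
  `pialt_of_temkin2013_rrLU_twoModelPatching` — the summit and the crux from
  `Temkin2013 ∧ (∀ p, RRLU_p) ∧ (∀ p, TwoModelPatching p)`.

Sources: M. Temkin, J. Algebra 373 (2013), Thm. 1.3.2, Rem. 1.3.5 (iii); O. Zariski, Ann. of
Math. 41 (1940) and 45 (1944); O. Piltant, RACSAM 107 (2013), Prop. 5.1 and Cor. 5.7.
-/

set_option linter.dupNamespace false -- mandated namespace of this single-conjunct summit

noncomputable section

open CategoryTheory AlgebraicGeometry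
open Literature.AlgebraicGeometry.Resolution

namespace Summit.ResolutionOfSingularities.ResolutionOfSingularities.Theorems.Pialt.RadiciallyRegular

open Summit.ResolutionOfSingularities.ResolutionOfSingularities.Theses.PAlteration (Pialt Picover)

/-! ## `LU_p ↔ RRLU_p` modulo `Temkin2013` -/

/-- **Local uniformization in characteristic `p` from `Temkin2013` and local uniformization of
normal radicially regular affine varieties** (every field of characteristic `p`): by
`exists_normal_rrModel_le_of_temkin2013` every valuation ring `O ∋ k` of a finitely generated
`K/k` contains a finitely generated, integrally closed affine model `T` of `K` onto whose
spectrum an integral regular scheme maps finitely, universally injectively and surjectively; the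
hypothesis uniformizes `O ⊇ T`. [cite: Temkin2013, Thm. 1.3.2 and Rem. 1.3.5 (iii)] -/
theorem localUniformizationInChar_of_temkin2013_of_rrLU (hT : Temkin2013.{0}) {p : ℕ}
    [Fact p.Prime]
    (hLU : ∀ (k K : Type) [Field k] [CharP k p] [Field K] [Algebra k K] (T : Subalgebra k K),
      T.FG → IsFractionRing T K → IsIntegrallyClosed T →
      (∃ (W : Scheme.{0}) (h : W ⟶ Spec (.of T)), IsIntegral W ∧ Scheme.IsRegular W ∧
        IsFinite h ∧ UniversallyInjective h ∧ Function.Surjective h.base) →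
      ∀ O : ValuationSubring K, T.toSubring ≤ O.toSubring → IsLocallyUniformizable k K O) :
    LocalUniformizationInChar.{0} p := by
  intro k K _ _ _ _ hfg O hO
  obtain ⟨T, hTO, hTfg, hTfr, hTn, hRR⟩ := exists_normal_rrModel_le_of_temkin2013 hT p k K hfg O hO
  exact hLU k K T hTfg hTfr hTn hRR O hTO

/-- **Conversely, local uniformization in characteristic `p` uniformizes in particular the
valuations centred on normal radicially regular affine varieties** (the hypothesis of
`localUniformizationInChar_of_temkin2013_of_rrLU`): `Frac T = K` with `T` finitely generated
makes `K/k` finitely generated, and `k ⊆ T ⊆ O`. [folklore] -/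
theorem rrLU_of_localUniformizationInChar {p : ℕ} (h : LocalUniformizationInChar.{0} p)
    (k K : Type) [Field k] [CharP k p] [Field K] [Algebra k K] (T : Subalgebra k K)
    (hTfg : T.FG) (hTfr : IsFractionRing T K) (_hTn : IsIntegrallyClosed T)
    (_hRR : ∃ (W : Scheme.{0}) (h : W ⟶ Spec (.of T)), IsIntegral W ∧ Scheme.IsRegular W ∧
      IsFinite h ∧ UniversallyInjective h ∧ Function.Surjective h.base)
    (O : ValuationSubring K) (hTO : T.toSubring ≤ O.toSubring) : IsLocallyUniformizable k K O := by
  haveI := hTfr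
  haveI : Algebra.FiniteType k T := T.fg_iff_finiteType.mp hTfg
  haveI : Algebra.EssFiniteType T K := Algebra.EssFiniteType.of_isLocalization K (nonZeroDivisors T)
  have hKfg : (⊤ : IntermediateField k K).FG :=
    IntermediateField.fg_top_iff.mpr (Algebra.EssFiniteType.comp k T K)
  exact h k K hKfg O fun c => hTO (T.algebraMap_mem c)

/-- **Modulo `Temkin2013`, Zariski local uniformization in characteristic `p` is EXACTLY local
uniformization of valuations centred on normal radicially regular affine varieties** (over
every field of characteristic `p`). [cite: Temkin2013, Thm. 1.3.2 and Rem. 1.3.5 (iii)] -/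
theorem localUniformizationInChar_iff_rrLU (hT : Temkin2013.{0}) (p : ℕ) [Fact p.Prime] :
    LocalUniformizationInChar.{0} p ↔
      ∀ (k K : Type) [Field k] [CharP k p] [Field K] [Algebra k K] (T : Subalgebra k K),
        T.FG → IsFractionRing T K → IsIntegrallyClosed T →
        (∃ (W : Scheme.{0}) (h : W ⟶ Spec (.of T)), IsIntegral W ∧ Scheme.IsRegular W ∧
          IsFinite h ∧ UniversallyInjective h ∧ Function.Surjective h.base) →
        ∀ O : ValuationSubring K, T.toSubring ≤ O.toSubring → IsLocallyUniformizable k K O :=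
  ⟨fun h k K _ _ _ _ T hTfg hTfr hTn hRR O hTO =>
      rrLU_of_localUniformizationInChar h k K T hTfg hTfr hTn hRR O hTO,
    fun h => localUniformizationInChar_of_temkin2013_of_rrLU hT h⟩

/-! ## Resolution in characteristic `p` ↔ RRLU ∧ two-model patching, modulo `Temkin2013` -/

/-- **Resolution in characteristic `p` from `Temkin2013`, local uniformization of normal
radicially regular affine varieties and two-model patching of proper models** — over EVERY field
of characteristic `p` (Zariski's programme with proper models and absolute local uniformization,
`resolutionInChar_of_properTwoModelPatching_of_lu`, fed with
`localUniformizationInChar_of_temkin2013_of_rrLU`). [cite: Piltant2013, Prop. 5.1 and Cor. 5.7] -/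
theorem resolutionInChar_of_temkin2013_rrLU_twoModelPatching (hT : Temkin2013.{0}) {p : ℕ}
    [Fact p.Prime]
    (hLU : ∀ (k K : Type) [Field k] [CharP k p] [Field K] [Algebra k K] (T : Subalgebra k K),
      T.FG → IsFractionRing T K → IsIntegrallyClosed T →
      (∃ (W : Scheme.{0}) (h : W ⟶ Spec (.of T)), IsIntegral W ∧ Scheme.IsRegular W ∧
        IsFinite h ∧ UniversallyInjective h ∧ Function.Surjective h.base) →
      ∀ O : ValuationSubring K, T.toSubring ≤ O.toSubring → IsLocallyUniformizable k K O)
    (hZ : ProperModel.TwoModelPatching.{0} p) : ResolutionInChar.{0} p :=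
  resolutionInChar_of_properTwoModelPatching_of_lu hZ
    (localUniformizationInChar_of_temkin2013_of_rrLU hT hLU)

/-- **Modulo `Temkin2013`, `ResolutionInChar p ↔ RRLU_p ∧ TwoModelPatching p`** over all fields
of characteristic `p`: resolution of singularities in characteristic `p` splits EXACTLY into
local uniformization in the inseparable case and Zariski–Piltant patching (`→`:
`ResolutionInChar.localUniformizationInChar` and `ProperModel.twoModelPatching_of_resolutionInChar`;
`←`: `resolutionInChar_of_temkin2013_rrLU_twoModelPatching`).
[cite: Piltant2013, Prop. 5.1 (P = P_reg)] -/
theorem resolutionInChar_iff_rrLU_and_twoModelPatching (hT : Temkin2013.{0}) (p : ℕ)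
    [Fact p.Prime] :
    ResolutionInChar.{0} p ↔
      (∀ (k K : Type) [Field k] [CharP k p] [Field K] [Algebra k K] (T : Subalgebra k K),
        T.FG → IsFractionRing T K → IsIntegrallyClosed T →
        (∃ (W : Scheme.{0}) (h : W ⟶ Spec (.of T)), IsIntegral W ∧ Scheme.IsRegular W ∧
          IsFinite h ∧ UniversallyInjective h ∧ Function.Surjective h.base) →
        ∀ O : ValuationSubring K, T.toSubring ≤ O.toSubring → IsLocallyUniformizable k K O) ∧
      ProperModel.TwoModelPatching.{0} p :=
  ⟨fun h => ⟨(localUniformizationInChar_iff_rrLU hT p).mp h.localUniformizationInChar,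
      ProperModel.twoModelPatching_of_resolutionInChar h⟩,
    fun h => resolutionInChar_of_temkin2013_rrLU_twoModelPatching hT h.1 h.2⟩

/-! ## The summit and the crux from `Temkin2013 ∧ RRLU ∧ two-model patching` -/

/-- **The summit from `Temkin2013`, RRLU in every prime characteristic and two-model patching in
every prime characteristic** (all fields; prime by prime
`resolutionInChar_of_temkin2013_rrLU_twoModelPatching`). [folklore] -/
theorem resolutionOfSingularities_of_temkin2013_rrLU_twoModelPatching (hT : Temkin2013.{0})
    (hLU : ∀ p : ℕ, p.Prime → ∀ (k K : Type) [Field k] [CharP k p] [Field K] [Algebra k K]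
      (T : Subalgebra k K), T.FG → IsFractionRing T K → IsIntegrallyClosed T →
      (∃ (W : Scheme.{0}) (h : W ⟶ Spec (.of T)), IsIntegral W ∧ Scheme.IsRegular W ∧
        IsFinite h ∧ UniversallyInjective h ∧ Function.Surjective h.base) →
      ∀ O : ValuationSubring K, T.toSubring ≤ O.toSubring → IsLocallyUniformizable k K O)
    (hZ : ∀ p : ℕ, p.Prime → ProperModel.TwoModelPatching.{0} p) :
    _root_.ResolutionOfSingularities := by
  intro p hp
  haveI : Fact p.Prime := ⟨hp⟩
  exact resolutionInChar_of_temkin2013_rrLU_twoModelPatching hT (hLU p hp) (hZ p hp)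

/-- **The crux `Pialt` from `Temkin2013`, RRLU and two-model patching** (through the summit and
the route's sandwich `resolutionOfSingularities_iff_pialt_and_picover`: a resolution is a purely
inseparable regular alteration). [folklore] -/
theorem pialt_of_temkin2013_rrLU_twoModelPatching (hT : Temkin2013.{0})
    (hLU : ∀ p : ℕ, p.Prime → ∀ (k K : Type) [Field k] [CharP k p] [Field K] [Algebra k K]
      (T : Subalgebra k K), T.FG → IsFractionRing T K → IsIntegrallyClosed T →
      (∃ (W : Scheme.{0}) (h : W ⟶ Spec (.of T)), IsIntegral W ∧ Scheme.IsRegular W ∧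
        IsFinite h ∧ UniversallyInjective h ∧ Function.Surjective h.base) →
      ∀ O : ValuationSubring K, T.toSubring ≤ O.toSubring → IsLocallyUniformizable k K O)
    (hZ : ∀ p : ℕ, p.Prime → ProperModel.TwoModelPatching.{0} p) : Pialt :=
  (resolutionOfSingularities_iff_pialt_and_picover.mp
    (resolutionOfSingularities_of_temkin2013_rrLU_twoModelPatching hT hLU hZ)).1

end Summit.ResolutionOfSingularities.ResolutionOfSingularities.Theorems.Pialt.RadiciallyRegular

end
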